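import Mathlib
import HarnessLib

/-!
# Wronskians of a derivation and a purity criterion

Topic: `Literature/RingTheory/Derivation`. For an `R`-derivation `D` of a commutative `R`-algebra
`S` and `θ ∈ S` we prove the **Wronskian identity**
`det (D^j (θ^l))_{l,j<n} = (∏_{l<n} l!) · ∏_{j<n} (D θ)^j`
(`det_wronskian`: the matrix factors as the lower triangular matrix `((θ^l)^{(i)})` times the
upper triangular matrix of the coefficients of the expansion `D^j (q(θ)) = Σ cᵢ q^{(i)}(θ)`,
`exists_iterate_aeval_expansion`), the base change `W_θ = N · W_e` to an `R`-basis `e` of `S`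
(`wronskian_eq_mul`), and the resulting **purity step** (`isUnit_det_basisWronskian`): if `S` is
a UFD, the `l!` (`l < n`) are units and no prime of `S` divides all `D (e i)`, then
`det (D^j (e i))` is a unit — so over a local `S` some `D (e i)` is a unit
(`exists_isUnit_derivation_apply_basis`). Also: the derivation `d/dT` of `R[T]/(f)` for `f' = 0`
(`exists_derivation_adjoinRoot`). These are the linear-algebra bricks of the rank-`p` case of the
Kimura–Niitsuma `p`-basis theorem (Matsumura, *Commutative Ring Theory*, end of §26) as used in
`Summits/ResolutionOfSingularities/…/PAlterationPicoverGoodRepresentativeConverse`.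

References: H. Matsumura, *Commutative Ring Theory*, CUP 1986, §25–§26. Elementary; no named
facts.
-/

namespace Literature.RingTheory.Derivation

open Polynomial IsLocalRing Module

/-! ### 1. The derivation `d/dT` on `R[T]/(f)` for `f' = 0` -/

/-- In characteristic `p`, `(X^p - h)' = 0`. [folklore] -/
theorem derivative_X_pow_sub_C_eq_zero {R : Type*} [CommRing R] (p : ℕ) [CharP R p]
    (h : R) : derivative ((X : R[X]) ^ p - C h) = 0 := by
  rw [derivative_sub, derivative_X_pow, derivative_C, sub_zero, CharP.cast_eq_zero R p, C_0,
    zero_mul]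

/-- **The derivation `d/dT` on `R[T]/(f)`** when `f' = 0`: an `R`-derivation `δ` with
`δ (q mod f) = q' mod f`. [folklore] -/
theorem exists_derivation_adjoinRoot {R : Type*} [CommRing R] (f : R[X])
    (hf : derivative f = 0) : ∃ δ : Derivation R (AdjoinRoot f) (AdjoinRoot f),
      ∀ q : R[X], δ (AdjoinRoot.mk f q) = AdjoinRoot.mk f (derivative q) := by
  let d₁ : R[X] →ₗ[R] AdjoinRoot f :=
    { toFun := fun q => AdjoinRoot.mk f (derivative q)
      map_add' := fun q r => by rw [derivative_add, map_add]
      map_smul' := fun c q => by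
        rw [derivative_smul, RingHom.id_apply, smul_eq_C_mul, map_mul, AdjoinRoot.mk_C,
          Algebra.smul_def, AdjoinRoot.algebraMap_eq] }
  have hd₁ : ∀ q, d₁ q = AdjoinRoot.mk f (derivative q) := fun q => rfl
  let I : Ideal R[X] := Ideal.span {f}
  have hker : I.restrictScalars R ≤ LinearMap.ker d₁ := by
    intro q hq
    rw [Submodule.restrictScalars_mem, Ideal.mem_span_singleton] at hq
    obtain ⟨r, rfl⟩ := hq
    rw [LinearMap.mem_ker, hd₁, derivative_mul, hf, zero_mul, zero_add, map_mul,
      AdjoinRoot.mk_self, zero_mul]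
  let d₂ : (R[X] ⧸ I.restrictScalars R) →ₗ[R] AdjoinRoot f := (I.restrictScalars R).liftQ _ hker
  let d₃ : AdjoinRoot f →ₗ[R] AdjoinRoot f :=
    d₂ ∘ₗ (Submodule.Quotient.restrictScalarsEquiv R I).symm.toLinearMap
  have hd₃ : ∀ q : R[X], d₃ (AdjoinRoot.mk f q) = AdjoinRoot.mk f (derivative q) := fun q => rfl
  refine ⟨Derivation.mk' d₃ ?_, hd₃⟩
  intro a b
  induction a using AdjoinRoot.induction_on with
  | ih q =>
    induction b using AdjoinRoot.induction_on with
    | ih r =>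
      rw [← map_mul, hd₃, hd₃, hd₃, derivative_mul, map_add, map_mul, map_mul, smul_eq_mul,
        smul_eq_mul]
      ring

/-! ### 2. The Wronskian identity -/

section Wronskian

variable {R S : Type*} [CommRing R] [CommRing S] [Algebra R S]

/-- Iterates of a derivation are the powers of the underlying linear map. [folklore] -/
theorem derivation_iterate_eq_pow_apply (D : Derivation R S S) (j : ℕ) (s : S) :
    (D : S → S)^[j] s = ((D : S →ₗ[R] S) ^ j) s := by
  rw [Module.End.pow_apply]
  rfl

/-- **Expansion of `D^j` along a polynomial in `θ`.** For every `j` there are coefficients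
`c 0, …, c j ∈ S` with `c j = (D θ)^j`, `c i = 0` for `i > j`, and
`D^j (q(θ)) = Σ_{i ≤ j} c i · q^{(i)}(θ)` for every `q ∈ R[X]`. [folklore] -/
theorem exists_iterate_aeval_expansion (D : Derivation R S S) (θ : S) : ∀ j : ℕ, ∃ c : ℕ → S,
    c j = D θ ^ j ∧ (∀ i, j < i → c i = 0) ∧ ∀ q : R[X], (D : S → S)^[j] (aeval θ q) =
      ∑ i ∈ Finset.range (j + 1), c i * aeval θ (derivative^[i] q) := by
  intro j
  induction j with
  | zero =>
    refine ⟨fun i => if i = 0 then 1 else 0, ?_, fun i hi => ?_, fun q => ?_⟩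
    · show (if (0 : ℕ) = 0 then (1 : S) else 0) = D θ ^ 0
      rw [if_pos rfl, pow_zero]
    · show (if i = 0 then (1 : S) else 0) = 0
      rw [if_neg (by omega)]
    · rw [Function.iterate_zero_apply, Finset.sum_range_one]
      show aeval θ q = (if (0 : ℕ) = 0 then (1 : S) else 0) * aeval θ (derivative^[0] q)
      rw [if_pos rfl, one_mul, Function.iterate_zero_apply]
  | succ j ih =>
    obtain ⟨c, hcj, hc0, hc⟩ := ih
    refine ⟨fun i => D (c i) + D θ * (if i = 0 then 0 else c (i - 1)), ?_, fun i hi => ?_,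
      fun q => ?_⟩
    · show D (c (j + 1)) + D θ * (if j + 1 = 0 then 0 else c (j + 1 - 1)) = D θ ^ (j + 1)
      rw [hc0 (j + 1) (Nat.lt_succ_self j), map_zero, zero_add, if_neg (Nat.succ_ne_zero j),
        Nat.succ_sub_one, hcj, pow_succ']
    · show D (c i) + D θ * (if i = 0 then 0 else c (i - 1)) = 0
      rw [hc0 i (by omega), map_zero, zero_add, if_neg (by omega), hc0 (i - 1) (by omega),
        mul_zero]
    show _ = ∑ i ∈ Finset.range (j + 1 + 1),
      (D (c i) + D θ * (if i = 0 then 0 else c (i - 1))) * aeval θ (derivative^[i] q)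
    rw [Function.iterate_succ_apply', hc, map_sum]
    have hterm : ∀ i, D (c i * aeval θ (derivative^[i] q)) =
        D (c i) * aeval θ (derivative^[i] q) + D θ * c i * aeval θ (derivative^[i + 1] q) := by
      intro i
      rw [Derivation.leibniz, Derivation.map_aeval, smul_eq_mul, smul_eq_mul,
        Function.iterate_succ_apply']
      ring
    simp_rw [hterm]
    rw [Finset.sum_add_distrib]
    have hrhs : ∑ i ∈ Finset.range (j + 1 + 1),
        (D (c i) + D θ * (if i = 0 then 0 else c (i - 1))) * aeval θ (derivative^[i] q) =
        ∑ i ∈ Finset.range (j + 1 + 1), D (c i) * aeval θ (derivative^[i] q) +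
        ∑ i ∈ Finset.range (j + 1 + 1),
          D θ * (if i = 0 then 0 else c (i - 1)) * aeval θ (derivative^[i] q) := by
      rw [← Finset.sum_add_distrib]
      refine Finset.sum_congr rfl fun i _ => ?_
      ring
    rw [hrhs, Finset.sum_range_succ _ (j + 1), hc0 (j + 1) (Nat.lt_succ_self j), map_zero,
      zero_mul, add_zero, Finset.sum_range_succ' _ (j + 1), if_pos rfl, mul_zero, zero_mul,
      add_zero]
    rw [add_right_inj]
    refine Finset.sum_congr rfl fun i _ => ?_
    rw [if_neg (Nat.succ_ne_zero i), Nat.succ_sub_one]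

/-- **Wronskian identity.** For an `R`-derivation `D` of `S` and `θ ∈ S`,
`det (D^j (θ^l))_{l,j<n} = (∏_{l<n} l!) · ∏_{j<n} (D θ)^j`: the matrix factors as the lower
triangular `(θ^l)^{(i)}` (diagonal `l!`) times the upper triangular expansion coefficients
(diagonal `(Dθ)^j`). [folklore] -/
theorem det_wronskian (D : Derivation R S S) (θ : S) (n : ℕ) :
    (Matrix.of fun l j : Fin n => (D : S → S)^[(j : ℕ)] (θ ^ (l : ℕ))).det =
      (∏ l : Fin n, ((l : ℕ).factorial : S)) * ∏ j : Fin n, D θ ^ (j : ℕ) := by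
  choose c hcj hc0 hc using exists_iterate_aeval_expansion D θ
  let V : Matrix (Fin n) (Fin n) S :=
    Matrix.of fun l i => aeval θ (derivative^[(i : ℕ)] ((X : R[X]) ^ (l : ℕ)))
  let C : Matrix (Fin n) (Fin n) S := Matrix.of fun i j => c j i
  have hW : (Matrix.of fun l j : Fin n => (D : S → S)^[(j : ℕ)] (θ ^ (l : ℕ))) = V * C := by
    ext l j
    rw [Matrix.mul_apply, Matrix.of_apply]
    have h1 : θ ^ (l : ℕ) = aeval θ ((X : R[X]) ^ (l : ℕ)) := by rw [map_pow, aeval_X]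
    rw [h1, hc]
    have h2 : ∑ i ∈ Finset.range ((j : ℕ) + 1),
          c j i * aeval θ (derivative^[i] ((X : R[X]) ^ (l : ℕ)))
        = ∑ i ∈ Finset.range n, c j i * aeval θ (derivative^[i] ((X : R[X]) ^ (l : ℕ))) := by
      refine Finset.sum_subset (Finset.range_subset_range.mpr (by omega)) fun i hi hi' => ?_
      rw [Finset.mem_range] at hi hi'
      rw [hc0 j i (by omega), zero_mul]
    rw [h2, ← Fin.sum_univ_eq_sum_range (fun i => c j i *
      aeval θ (derivative^[i] ((X : R[X]) ^ (l : ℕ)))) n]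
    refine Finset.sum_congr rfl fun i _ => ?_
    simp only [V, C, Matrix.of_apply]
    exact mul_comm _ _
  have hV : V.det = ∏ l : Fin n, ((l : ℕ).factorial : S) := by
    rw [Matrix.det_of_lowerTriangular V ?_]
    · refine Finset.prod_congr rfl fun l _ => ?_
      simp only [V, Matrix.of_apply]
      rw [iterate_derivative_X_pow_eq_smul, map_smul, map_pow, aeval_X, Nat.sub_self, pow_zero,
        Nat.descFactorial_self, Nat.cast_smul_eq_nsmul, nsmul_eq_mul, mul_one]
    · intro l i hli
      have hli' : (l : ℕ) < (i : ℕ) := hli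
      simp only [V, Matrix.of_apply]
      rw [iterate_derivative_X_pow_eq_smul, (Nat.descFactorial_eq_zero_iff_lt).mpr hli',
        Nat.cast_zero, zero_smul, map_zero]
  have hC : C.det = ∏ j : Fin n, D θ ^ (j : ℕ) := by
    rw [Matrix.det_of_upperTriangular ?_]
    · refine Finset.prod_congr rfl fun j _ => ?_
      simp only [C, Matrix.of_apply]
      exact hcj j
    · intro i j hij
      have hij' : (j : ℕ) < (i : ℕ) := hij
      simp only [C, Matrix.of_apply]
      exact hc0 j i hij'
  rw [hW, Matrix.det_mul, hV, hC]

/-- **`W_θ = N · W_e`**: the Wronskian of the powers of `θ` is the coordinate matrix of these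
powers (in an `R`-basis `e`) times the basis Wronskian `(D^j (e i))`. [folklore] -/
theorem wronskian_eq_mul {n : ℕ} (D : Derivation R S S) (e : Basis (Fin n) R S) (θ : S) :
    (Matrix.of fun l j : Fin n => (D : S → S)^[(j : ℕ)] (θ ^ (l : ℕ))) =
      (Matrix.of fun l i : Fin n => algebraMap R S (e.repr (θ ^ (l : ℕ)) i)) *
        Matrix.of fun i j : Fin n => (D : S → S)^[(j : ℕ)] (e i) := by
  ext l j
  rw [Matrix.mul_apply, Matrix.of_apply]
  conv_lhs => rw [← e.sum_repr (θ ^ (l : ℕ)), derivation_iterate_eq_pow_apply, map_sum]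
  refine Finset.sum_congr rfl fun i _ => ?_
  rw [map_smul, ← derivation_iterate_eq_pow_apply, Algebra.smul_def, Matrix.of_apply, Matrix.of_apply]

/-- **Purity step.** If no prime of the UFD `S` divides all the `D (e i)` (`e` an `R`-basis of
`S`), the factorials `l!`, `l < n`, are units and `S` has a prime element, then the basis
Wronskian `det (D^j (e i))` is a unit: by the Wronskian identity no prime divides it.
[folklore] -/
theorem isUnit_det_basisWronskian [IsDomain S] [UniqueFactorizationMonoid S] {n : ℕ}
    (D : Derivation R S S) (e : Basis (Fin n) R S)
    (hsat : ∀ π : S, Prime π → ∃ i, ¬ π ∣ D (e i))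
    (hfact : ∀ l : ℕ, l < n → IsUnit ((l.factorial : ℕ) : S)) (hprime : ∃ π : S, Prime π) :
    IsUnit (Matrix.of fun i j : Fin n => (D : S → S)^[(j : ℕ)] (e i)).det := by
  have key : ∀ π : S, Prime π →
      ¬ π ∣ (Matrix.of fun i j : Fin n => (D : S → S)^[(j : ℕ)] (e i)).det := by
    intro π hπ hdvd
    obtain ⟨i, hi⟩ := hsat π hπ
    have h1 : π ∣ (Matrix.of fun l j : Fin n => (D : S → S)^[(j : ℕ)] (e i ^ (l : ℕ))).det := by
      rw [wronskian_eq_mul D e (e i), Matrix.det_mul]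
      exact dvd_mul_of_dvd_right hdvd _
    rw [det_wronskian] at h1
    rcases hπ.dvd_or_dvd h1 with h2 | h2
    · obtain ⟨l, -, hl⟩ := (Prime.dvd_finsetProd_iff hπ _).mp h2
      exact hπ.not_unit (isUnit_of_dvd_unit hl (hfact l l.2))
    · obtain ⟨j, -, hj⟩ := (Prime.dvd_finsetProd_iff hπ _).mp h2
      exact hi (hπ.dvd_of_dvd_pow hj)
  obtain ⟨π₀, hπ₀⟩ := hprime
  have hne : (Matrix.of fun i j : Fin n => (D : S → S)^[(j : ℕ)] (e i)).det ≠ 0 :=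
    fun h0 => key π₀ hπ₀ (h0 ▸ dvd_zero π₀)
  by_contra hu
  obtain ⟨q, hq, hqd⟩ := WfDvdMonoid.exists_irreducible_factor hu hne
  exact key q (UniqueFactorizationMonoid.irreducible_iff_prime.mp hq) hqd

/-- In a local ring, if the basis Wronskian `det (D^j (e i))` is a unit (`n ≥ 2`) then some
`D (e i)` is a unit: otherwise `D(S) ⊆ 𝔫` and the column `j = 1` vanishes in `κ(S)`.
[folklore] -/
theorem exists_isUnit_derivation_apply_basis [IsLocalRing S] {n : ℕ} (hn : 2 ≤ n)
    (D : Derivation R S S) (e : Basis (Fin n) R S)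
    (hunit : IsUnit (Matrix.of fun i j : Fin n => (D : S → S)^[(j : ℕ)] (e i)).det) :
    ∃ i, IsUnit (D (e i)) := by
  by_contra hcon
  push Not at hcon
  have hall : ∀ s : S, D s ∈ maximalIdeal S := by
    intro s
    rw [← e.sum_repr s, map_sum]
    refine Ideal.sum_mem _ fun i _ => ?_
    rw [Derivation.map_smul, Algebra.smul_def]
    exact Ideal.mul_mem_left _ _ (hcon i)
  apply (mem_maximalIdeal _).mp ?_ hunit
  rw [← residue_eq_zero_iff, RingHom.map_det]
  refine Matrix.det_eq_zero_of_column_eq_zero ⟨1, by omega⟩ fun i => ?_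
  rw [RingHom.mapMatrix_apply, Matrix.map_apply, Matrix.of_apply, residue_eq_zero_iff]
  exact hall (e i)

end Wronskian

end Literature.RingTheory.Derivation
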